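import Summits.Ventures.LatticeQCDFlow.Scaling.ReplicaExchangeBareSampler

/-!
HONEST FRAMING: exact (Metropolis-corrected) sampling algorithms for lattice gauge theory; figures
of merit are autocorrelation/cost numbers at stated couplings and volumes; no continuum-physics
claim.

# HomLadderOneLevelModes — THE HOMOGENEOUS LADDER `t·Sw + (1−t)·Upd_w` (ONE LAW `ν` AT EVERY LEVEL, EXACT HOT REDRAW, IDLE COLD KERNELS): EVERY SWAP IS ACCEPTED,
# AND A ONE-LEVEL SUM `Φ(x) = Σ_k c_k·a(x_k)` (`a` CENTRED FOR `ν`) MOVES IN EXPECTATION BY `(t/K)Δ_Neumann − h·e_0e_0ᵀ` (`h = (1−t)w_0`):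
# `PΦ = Φ + (t/K)Σ_j(c_j − c_{j+1})(a(x_{j+1}) − a(x_j)) − h·c_0·a(x_0)`; UNDER THE THREE MODE EQUATIONS `PΦ = (1−ρ)Φ` EXACTLY; WILSON INCREMENTS `≤ tθ² + h·c_0²`
# (lean-2 GEN-47, ours)

Venture-side (OURS).  Cell `lqcd-flow` (pub-lqcd), unit `pub-lqcd-lean-2-g47`, 2026-08-31.  Chapter AG (the homogeneous ladder's law-free `K³·log K` floor), file 2 — the chain
side.  Setting: `K+1` levels over a finite `S`, ONE positive law `ν` at every level (the ladder with perfect adjacent transports, in level coordinates — chapter I file 3), the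
weighted ladder of chapter I file 14, `P = t·ptBareSwap ν^{⊗} + (1−t)·prodKernel w M` (a uniformly proposed adjacent Metropolis swap with probability `t`, else replica `k` is
updated with probability `w_k`), with the EXACT hot sampler `M_0(u,·) = ν` and IDLE cold kernels `M_{k+1} = 1`; `h = (1−t)w_0` is the hot redraw rate.  The kernel is carried as a
hypothesis-equation `hP` (so that `ptBareSampler t ν^{⊗} M`, uniform weights, is the case `w ≡ 1/(K+1)`).  No definitions.

* §1 `sum_ptBareProposal_eq_one` (`K ≥ 1`), `tensorFun_const_comp_levelSwap`, **`ptBareSwap_const_eq_proposal`** — EVERY SWAP IS ACCEPTED (`ν^{⊗(K+1)}` is exchangeable).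
* §2 **`homLadder_sum_mul`** — the one-step action on any `G`: `Σ_yP(x,y)G(y) = (t/K)Σ_jG(x∘σ_j) + (1−t)(w_0Σ_vν(v)G(x[0↦v]) + (1−w_0)G(x))`;
  `oneLevel_comp_levelSwap` (`Φ(x∘σ_j) = Φ(x) + (c_j − c_{j+1})(a(x_{j+1}) − a(x_j))`), `oneLevel_update_zero`, `oneLevel_redraw` (`Σ_vν(v)Φ(x[0↦v]) = Φ(x) − c_0a(x_0)`);
  **`homLadder_apply_oneLevel`** — `PΦ = Φ + (t/K)Σ_j(c_j − c_{j+1})(a(x_{j+1}) − a(x_j)) − h·c_0·a(x_0)`.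
* §3 `oneLevel_edge_sum_eq` (summation by parts along the ladder); **`homLadder_oneLevel_eigen`** — under the hot-end, interior and far-end equations
  `(t/K)(c_1 − c_0) − hc_0 = −ρc_0`, `(t/K)(c_n − 2c_{n+1} + c_{n+2}) = −ρc_{n+1}`, `(t/K)(c_{K−1} − c_K) = −ρc_K`: **`PΦ = (1−ρ)Φ`**, an EXACT eigenfunction.
* §4 **`homLadder_oneLevel_increment_le`** — `(c_n − c_{n+1})² ≤ θ²` and `(a(v) − a(v'))² ≤ 1` ⇒ `Σ_yP(x,y)(Φ(y) − Φ(x))² ≤ tθ² + h·c_0²`.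

Reading (no numerics implied): with one law at every level the ladder is a random-adjacent-transposition shuffle of the replica contents plus a source of fresh content at the hot
end; one-level statistics see only the discrete heat equation with a Neumann far end and a Robin hot end.  NOT CLAIMED here: the mode (file 1), ergodicity and the floor
(file 3).
Literature grade (cell rule): ELEMENTARY, NEW TYPING; nothing cited as a fact; no new bib keys.
-/

noncomputable section

open Finset Function
open Literature.Probability.MarkovChains

namespace Summit.Ventures.LatticeQCDFlow.Scaling

variable {S : Type*} [Fintype S] [DecidableEq S] {K : ℕ} {ν : S → ℝ} {M : Fin (K + 1) → S → S → ℝ} {w : Fin (K + 1) → ℝ} {t : ℝ}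

/-! ## §1 Every swap is accepted -/

/-- The adjacent proposal has row sums exactly `1` when `K ≥ 1`. [ours] -/
theorem sum_ptBareProposal_eq_one (hK : 1 ≤ K) (x : Fin (K + 1) → S) : ∑ y, ptBareProposal x y = 1 := by
  have hKpos : (0 : ℝ) < K := Nat.cast_pos.mpr (by omega)
  unfold ptBareProposal
  rw [Finset.sum_comm]
  simp_rw [Finset.sum_ite_eq' univ, if_pos (mem_univ _)]
  rw [sum_const, card_univ, Fintype.card_fin, nsmul_eq_mul, mul_one_div_cancel hKpos.ne']

omit [Fintype S] [DecidableEq S] in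
/-- `ν^{⊗(K+1)}` is invariant under an adjacent exchange. [ours] -/
theorem tensorFun_const_comp_levelSwap (ν : S → ℝ) (j : Fin K) (x : Fin (K + 1) → S) :
    tensorFun (fun _ : Fin (K + 1) => ν) (x ∘ levelSwap j) = tensorFun (fun _ : Fin (K + 1) => ν) x := by
  unfold tensorFun levelSwap
  exact Equiv.prod_comp (Equiv.swap j.castSucc j.succ) (fun k => ν (x k))

/-- **EVERY SWAP IS ACCEPTED:** with one positive law at every level the Metropolis adjacent swap IS its proposal, `Sw(x,y) = T(x,y)` (`K ≥ 1`). [ours] -/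
theorem ptBareSwap_const_eq_proposal (hK : 1 ≤ K) (hν : ∀ v, 0 < ν v) (x y : Fin (K + 1) → S) :
    ptBareSwap (fun _ : Fin (K + 1) => ν) x y = ptBareProposal x y := by
  have hμ : ∀ (k : Fin (K + 1)) (v : S), 0 < (fun _ : Fin (K + 1) => ν) k v := fun _ v => hν v
  have hπ := tensorFun_pos hμ
  -- off the diagonal
  have hoff : ∀ x y : Fin (K + 1) → S, y ≠ x → ptBareSwap (fun _ : Fin (K + 1) => ν) x y = ptBareProposal x y := by
    intro x y hyx
    have h := tensorFun_mul_ptBareSwap hμ hyx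
    by_cases hT : ptBareProposal x y = 0
    · rw [hT, zero_mul] at h
      rw [hT]
      rcases mul_eq_zero.mp h with h0 | h0
      · exact absurd h0 (hπ x).ne'
      · exact h0
    · have hex : ∃ j : Fin K, y = x ∘ levelSwap j := by
        by_contra hne
        apply hT
        unfold ptBareProposal
        exact sum_eq_zero fun j _ => if_neg fun h' => hne ⟨j, h'⟩
      obtain ⟨j, hj⟩ := hex
      have hπeq : tensorFun (fun _ : Fin (K + 1) => ν) y = tensorFun (fun _ : Fin (K + 1) => ν) x := by
        rw [hj, tensorFun_const_comp_levelSwap]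
      rw [hπeq, min_self, mul_comm] at h
      exact mul_right_cancel₀ (hπ x).ne' h
  by_cases hyx : y ≠ x
  · exact hoff x y hyx
  push Not at hyx
  subst hyx
  have hS := (ptBareSwap_isRowStochastic hμ).2 y
  have hT := sum_ptBareProposal_eq_one hK y
  rw [← Finset.add_sum_erase _ _ (mem_univ y)] at hS hT
  have he : ∑ z ∈ univ.erase y, ptBareSwap (fun _ : Fin (K + 1) => ν) y z = ∑ z ∈ univ.erase y, ptBareProposal y z :=
    sum_congr rfl fun z hz => hoff y z (Finset.ne_of_mem_erase hz)
  linarith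

/-! ## §2 The one-step action on one-level sums -/

section Ladder
variable {P : (Fin (K + 1) → S) → (Fin (K + 1) → S) → ℝ}

/-- **THE ONE-STEP ACTION ON ANY TEST FUNCTION:** `Σ_y P(x,y)G(y) = (t/K)·Σ_j G(x∘σ_j) + (1−t)·(w_0·Σ_v ν(v)G(x[0↦v]) + (1−w_0)·G(x))`
(every swap accepted; the hot kernel redraws, the cold kernels idle). [ours] -/
theorem homLadder_sum_mul (hK : 1 ≤ K) (hν : ∀ v, 0 < ν v)
    (hM0 : ∀ u v, M 0 u v = ν v) (hidle : ∀ i : Fin K, ∀ u v, M i.succ u v = if v = u then 1 else 0) (hw1 : ∑ k, w k = 1)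
    (hP : ∀ x y, P x y = t * ptBareSwap (fun _ : Fin (K + 1) => ν) x y + (1 - t) * prodKernel w M x y)
    (x : Fin (K + 1) → S) (G : (Fin (K + 1) → S) → ℝ) :
    ∑ y, P x y * G y = t / K * ∑ j : Fin K, G (x ∘ levelSwap j) + (1 - t) * (w 0 * ∑ v, ν v * G (update x 0 v) + (1 - w 0) * G x) := by
  have hsw : ∑ y, ptBareSwap (fun _ : Fin (K + 1) => ν) x y * G y = 1 / K * ∑ j : Fin K, G (x ∘ levelSwap j) := by
    simp_rw [ptBareSwap_const_eq_proposal hK hν]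
    unfold ptBareProposal
    simp_rw [sum_mul]
    rw [sum_comm]
    rw [mul_sum]
    refine sum_congr rfl fun j _ => ?_
    simp_rw [ite_mul, zero_mul]
    rw [sum_ite_eq' univ (x ∘ levelSwap j), if_pos (mem_univ _)]
  have hup : ∑ y, prodKernel w M x y * G y = w 0 * ∑ v, ν v * G (update x 0 v) + (1 - w 0) * G x := by
    rw [sum_prodKernel_mul, Fin.sum_univ_succ]
    congr 1
    · simp_rw [hM0]
    · have hi : ∀ i : Fin K, ∑ v, M i.succ (x i.succ) v * G (update x i.succ v) = G x := by
        intro i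
        simp_rw [hidle i, ite_mul, one_mul, zero_mul]
        rw [sum_ite_eq' univ (x i.succ), if_pos (mem_univ _), update_eq_self]
      simp_rw [hi]
      rw [← sum_mul]
      congr 1
      have := hw1
      rw [Fin.sum_univ_succ] at this
      linarith
  simp_rw [hP, add_mul, sum_add_distrib, mul_assoc, ← mul_sum, hsw, hup]
  have hKpos : (0 : ℝ) < K := Nat.cast_pos.mpr (by omega)
  field_simp

variable {c : ℕ → ℝ} {a : S → ℝ} {Φ : (Fin (K + 1) → S) → ℝ}

omit [Fintype S] [DecidableEq S] in
/-- **A swap on a one-level sum:** `Φ(x∘σ_j) = Φ(x) + (c_j − c_{j+1})·(a(x_{j+1}) − a(x_j))`. [ours] -/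
theorem oneLevel_comp_levelSwap (hΦ : ∀ x, Φ x = ∑ k : Fin (K + 1), c k * a (x k)) (x : Fin (K + 1) → S) (j : Fin K) :
    Φ (x ∘ levelSwap j) = Φ x + (c j - c (j + 1)) * (a (x j.succ) - a (x j.castSucc)) := by
  have hne : j.castSucc ≠ j.succ := fun e => by have := congrArg Fin.val e; simp at this
  rw [hΦ, hΦ]
  -- re-index the swapped sum
  have h1 : ∑ k : Fin (K + 1), c k * a ((x ∘ levelSwap j) k) = ∑ k : Fin (K + 1), c (levelSwap j k : Fin (K + 1)) * a (x k) := by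
    have := Equiv.sum_comp (levelSwap j) (fun k : Fin (K + 1) => c (levelSwap j k : Fin (K + 1)) * a (x k))
    simp only [Function.comp_apply] at this ⊢
    rw [← this]
    refine sum_congr rfl fun k _ => ?_
    unfold levelSwap
    rw [Equiv.swap_apply_self]
  rw [h1, ← sub_eq_iff_eq_add', ← sum_sub_distrib]
  have h2 : ∀ k : Fin (K + 1), c (levelSwap j k : Fin (K + 1)) * a (x k) - c k * a (x k) = (c (levelSwap j k : Fin (K + 1)) - c k) * a (x k) := fun k => by ring
  simp_rw [h2]
  rw [Fintype.sum_eq_add j.castSucc j.succ hne]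
  · unfold levelSwap
    rw [Equiv.swap_apply_left, Equiv.swap_apply_right]
    simp only [Fin.val_castSucc, Fin.val_succ]
    ring
  · intro k hk
    unfold levelSwap
    rw [Equiv.swap_apply_of_ne_of_ne hk.1 hk.2, sub_self, zero_mul]

omit [Fintype S] [DecidableEq S] in
/-- A hot redraw on a one-level sum: `Φ(x[0↦v]) = Φ(x) + c_0·(a(v) − a(x_0))`. [ours] -/
theorem oneLevel_update_zero (hΦ : ∀ x, Φ x = ∑ k : Fin (K + 1), c k * a (x k)) (x : Fin (K + 1) → S) (v : S) :
    Φ (update x 0 v) = Φ x + c 0 * (a v - a (x 0)) := by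
  rw [hΦ, hΦ, ← sub_eq_iff_eq_add', ← sum_sub_distrib]
  rw [Finset.sum_eq_single (0 : Fin (K + 1))]
  · rw [update_self]; simp only [Fin.val_zero]; ring
  · intro k _ hk; rw [update_of_ne hk, sub_self]
  · intro h; exact absurd (mem_univ _) h

omit [DecidableEq S] in
/-- **The exact redraw averages the hot term away:** `Σ_v ν(v)Φ(x[0↦v]) = Φ(x) − c_0·a(x_0)` (`Σν = 1`, `Σνa = 0`). [ours] -/
theorem oneLevel_redraw (hν1 : ∑ v, ν v = 1) (ha0 : ∑ v, ν v * a v = 0) (hΦ : ∀ x, Φ x = ∑ k : Fin (K + 1), c k * a (x k))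
    (x : Fin (K + 1) → S) : ∑ v, ν v * Φ (update x 0 v) = Φ x - c 0 * a (x 0) := by
  simp_rw [oneLevel_update_zero hΦ x]
  have e : ∀ v, ν v * (Φ x + c 0 * (a v - a (x 0))) = (Φ x - c 0 * a (x 0)) * ν v + c 0 * (ν v * a v) := fun v => by ring
  simp_rw [e]
  rw [sum_add_distrib, ← mul_sum, ← mul_sum, hν1, ha0]
  ring

/-- **THE LADDER ACTS ON ONE-LEVEL SUMS BY `(t/K)Δ_Neumann − h·e_0e_0ᵀ`:**
`Σ_yP(x,y)Φ(y) = Φ(x) + (t/K)·Σ_j(c_j − c_{j+1})(a(x_{j+1}) − a(x_j)) − (1−t)w_0·c_0·a(x_0)`. [ours] -/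
theorem homLadder_apply_oneLevel (hK : 1 ≤ K) (hν : ∀ v, 0 < ν v) (hν1 : ∑ v, ν v = 1)
    (hM0 : ∀ u v, M 0 u v = ν v) (hidle : ∀ i : Fin K, ∀ u v, M i.succ u v = if v = u then 1 else 0) (hw1 : ∑ k, w k = 1)
    (hP : ∀ x y, P x y = t * ptBareSwap (fun _ : Fin (K + 1) => ν) x y + (1 - t) * prodKernel w M x y)
    (ha0 : ∑ v, ν v * a v = 0) (hΦ : ∀ x, Φ x = ∑ k : Fin (K + 1), c k * a (x k)) (x : Fin (K + 1) → S) :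
    ∑ y, P x y * Φ y = Φ x + t / K * ∑ j : Fin K, (c j - c (j + 1)) * (a (x j.succ) - a (x j.castSucc)) - (1 - t) * w 0 * (c 0 * a (x 0)) := by
  have hKpos : (0 : ℝ) < K := Nat.cast_pos.mpr (by omega)
  rw [homLadder_sum_mul hK hν hM0 hidle hw1 hP x Φ, oneLevel_redraw hν1 ha0 hΦ x]
  simp_rw [oneLevel_comp_levelSwap hΦ x]
  rw [sum_add_distrib, sum_const, card_univ, Fintype.card_fin, nsmul_eq_mul]
  field_simp
  ring

/-! ## §3 Summation by parts and the exact eigenfunction -/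

omit [Fintype S] [DecidableEq S] in
/-- **Summation by parts along the ladder:**
`Σ_j(c_j − c_{j+1})(a(x_{j+1}) − a(x_j)) = Σ_k [ 1{k≠0}(c_{k−1} − c_k) − 1{k≠K}(c_k − c_{k+1}) ]·a(x_k)`. [ours] -/
theorem oneLevel_edge_sum_eq (c : ℕ → ℝ) (a : S → ℝ) (x : Fin (K + 1) → S) :
    ∑ j : Fin K, (c j - c (j + 1)) * (a (x j.succ) - a (x j.castSucc))
      = ∑ k : Fin (K + 1), ((if (k : ℕ) = 0 then 0 else c ((k : ℕ) - 1) - c k) - (if (k : ℕ) = K then 0 else c k - c (k + 1))) * a (x k) := by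
  have hA : ∑ k : Fin (K + 1), (if (k : ℕ) = 0 then 0 else c ((k : ℕ) - 1) - c k) * a (x k) = ∑ j : Fin K, (c j - c (j + 1)) * a (x j.succ) := by
    rw [Fin.sum_univ_succ]
    simp only [Fin.val_zero, if_true, zero_mul, zero_add, Fin.val_succ, Nat.add_sub_cancel, Nat.succ_ne_zero, if_false]
  have hB : ∑ k : Fin (K + 1), (if (k : ℕ) = K then 0 else c k - c (k + 1)) * a (x k) = ∑ j : Fin K, (c j - c (j + 1)) * a (x j.castSucc) := by
    rw [Fin.sum_univ_castSucc]
    simp only [Fin.val_castSucc, Fin.val_last, if_true, zero_mul, add_zero]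
    refine sum_congr rfl fun j _ => ?_
    rw [if_neg (by have := j.2; omega)]
  calc ∑ j : Fin K, (c j - c (j + 1)) * (a (x j.succ) - a (x j.castSucc))
      = ∑ j : Fin K, (c j - c (j + 1)) * a (x j.succ) - ∑ j : Fin K, (c j - c (j + 1)) * a (x j.castSucc) := by
        rw [← sum_sub_distrib]; exact sum_congr rfl fun j _ => by ring
    _ = ∑ k : Fin (K + 1), (if (k : ℕ) = 0 then 0 else c ((k : ℕ) - 1) - c k) * a (x k)
          - ∑ k : Fin (K + 1), (if (k : ℕ) = K then 0 else c k - c (k + 1)) * a (x k) := by rw [hA, hB]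
    _ = _ := by rw [← sum_sub_distrib]; exact sum_congr rfl fun k _ => by ring

/-- **AN EXACT EIGENFUNCTION:** if `c` solves the hot-end equation `(t/K)(c_1 − c_0) − (1−t)w_0·c_0 = −ρc_0`, the interior equations
`(t/K)(c_n − 2c_{n+1} + c_{n+2}) = −ρc_{n+1}` (`n+2 ≤ K`) and the far-end equation `(t/K)(c_{K−1} − c_K) = −ρc_K` (`K ≥ 1`), then
**`Σ_yP(x,y)Φ(y) = (1−ρ)·Φ(x)`** for every `x`. [ours] -/
theorem homLadder_oneLevel_eigen (hK : 1 ≤ K) (hν : ∀ v, 0 < ν v) (hν1 : ∑ v, ν v = 1)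
    (hM0 : ∀ u v, M 0 u v = ν v) (hidle : ∀ i : Fin K, ∀ u v, M i.succ u v = if v = u then 1 else 0) (hw1 : ∑ k, w k = 1)
    (hP : ∀ x y, P x y = t * ptBareSwap (fun _ : Fin (K + 1) => ν) x y + (1 - t) * prodKernel w M x y)
    (ha0 : ∑ v, ν v * a v = 0) (hΦ : ∀ x, Φ x = ∑ k : Fin (K + 1), c k * a (x k)) {ρ : ℝ}
    (h0 : t / K * (c 1 - c 0) - (1 - t) * w 0 * c 0 = -ρ * c 0)
    (hint : ∀ n : ℕ, n + 2 ≤ K → t / K * (c n - 2 * c (n + 1) + c (n + 2)) = -ρ * c (n + 1))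
    (hfar : t / K * (c (K - 1) - c K) = -ρ * c K) (x : Fin (K + 1) → S) :
    ∑ y, P x y * Φ y = (1 - ρ) * Φ x := by
  rw [homLadder_apply_oneLevel hK hν hν1 hM0 hidle hw1 hP ha0 hΦ x, oneLevel_edge_sum_eq c a x]
  -- everything as one sum over the levels
  have hhot : (1 - t) * w 0 * (c 0 * a (x 0)) = ∑ k : Fin (K + 1), (if (k : ℕ) = 0 then (1 - t) * w 0 * c 0 else 0) * a (x k) := by
    rw [Fin.sum_univ_succ]
    simp only [Fin.val_zero, if_true, Fin.val_succ, Nat.succ_ne_zero, if_false, zero_mul, sum_const_zero, add_zero]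
    ring
  -- the coefficient of `a(x_k)` vanishes, level by level
  have key : ∀ k : Fin (K + 1), t / K * ((if (k : ℕ) = 0 then 0 else c ((k : ℕ) - 1) - c k) - (if (k : ℕ) = K then 0 else c k - c (k + 1)))
      - (if (k : ℕ) = 0 then (1 - t) * w 0 * c 0 else 0) + ρ * c k = 0 := by
    intro k
    have hkK : (k : ℕ) ≤ K := Nat.lt_succ_iff.mp k.2
    by_cases hk0 : (k : ℕ) = 0
    · rw [if_pos hk0, if_pos hk0, if_neg (by omega), hk0]
      simp only [zero_add]
      linarith [h0]
    · rw [if_neg hk0, if_neg hk0]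
      by_cases hkK' : (k : ℕ) = K
      · rw [if_pos hkK', hkK']
        linarith [hfar]
      · rw [if_neg hkK']
        obtain ⟨m, hm⟩ := Nat.exists_eq_succ_of_ne_zero hk0
        have hm2 : m + 2 ≤ K := by omega
        have h := hint m hm2
        rw [hm, Nat.succ_sub_one]
        have e1 : c m.succ = c (m + 1) := rfl
        have e2 : c (m.succ + 1) = c (m + 2) := rfl
        rw [e1, e2]
        linarith [h]
  have hsum : t / K * ∑ k : Fin (K + 1), ((if (k : ℕ) = 0 then 0 else c ((k : ℕ) - 1) - c k) - (if (k : ℕ) = K then 0 else c k - c (k + 1))) * a (x k)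
      - (1 - t) * w 0 * (c 0 * a (x 0)) + ρ * Φ x
      = ∑ k : Fin (K + 1), (t / K * ((if (k : ℕ) = 0 then 0 else c ((k : ℕ) - 1) - c k) - (if (k : ℕ) = K then 0 else c k - c (k + 1)))
          - (if (k : ℕ) = 0 then (1 - t) * w 0 * c 0 else 0) + ρ * c k) * a (x k) := by
    rw [hhot, hΦ x, mul_sum, mul_sum, ← sum_sub_distrib, ← sum_add_distrib]
    exact sum_congr rfl fun k _ => by ring
  have hzero : t / K * ∑ k : Fin (K + 1), ((if (k : ℕ) = 0 then 0 else c ((k : ℕ) - 1) - c k) - (if (k : ℕ) = K then 0 else c k - c (k + 1))) * a (x k)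
      - (1 - t) * w 0 * (c 0 * a (x 0)) + ρ * Φ x = 0 := by
    rw [hsum]
    exact sum_eq_zero fun k _ => by rw [key k, zero_mul]
  linarith

/-! ## §4 Wilson's increment bound -/

/-- **ONE-STEP SQUARE INCREMENTS:** `(c_n − c_{n+1})² ≤ θ²` for all `n` and `(a(v) − a(v'))² ≤ 1` for all `v, v'` ⇒
**`Σ_yP(x,y)(Φ(y) − Φ(x))² ≤ t·θ² + (1−t)w_0·c_0²`** (`0 ≤ t ≤ 1`, `0 ≤ w_0`). [ours] -/
theorem homLadder_oneLevel_increment_le (hK : 1 ≤ K) (hν : ∀ v, 0 < ν v) (hν1 : ∑ v, ν v = 1)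
    (hM0 : ∀ u v, M 0 u v = ν v) (hidle : ∀ i : Fin K, ∀ u v, M i.succ u v = if v = u then 1 else 0)
    (hw0 : 0 ≤ w 0) (hw1 : ∑ k, w k = 1) (ht0 : 0 ≤ t) (ht1 : t ≤ 1)
    (hP : ∀ x y, P x y = t * ptBareSwap (fun _ : Fin (K + 1) => ν) x y + (1 - t) * prodKernel w M x y)
    (hΦ : ∀ x, Φ x = ∑ k : Fin (K + 1), c k * a (x k)) {θsq : ℝ} (hc : ∀ n : ℕ, (c n - c (n + 1)) ^ 2 ≤ θsq)
    (ha : ∀ v v', (a v - a v') ^ 2 ≤ 1) (x : Fin (K + 1) → S) :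
    ∑ y, P x y * (Φ y - Φ x) ^ 2 ≤ t * θsq + (1 - t) * w 0 * c 0 ^ 2 := by
  have hKpos : (0 : ℝ) < K := Nat.cast_pos.mpr (by omega)
  rw [homLadder_sum_mul hK hν hM0 hidle hw1 hP x (fun y => (Φ y - Φ x) ^ 2)]
  simp only [sub_self]
  -- the swap part
  have hsw : ∑ j : Fin K, (Φ (x ∘ levelSwap j) - Φ x) ^ 2 ≤ K * θsq := by
    have hj : ∀ j : Fin K, (Φ (x ∘ levelSwap j) - Φ x) ^ 2 ≤ θsq := by
      intro j
      rw [oneLevel_comp_levelSwap hΦ x j, add_sub_cancel_left, mul_pow]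
      have h1 := hc j
      have h2 := ha (x j.succ) (x j.castSucc)
      have hθ0 : 0 ≤ θsq := le_trans (sq_nonneg _) (hc 0)
      calc (c j - c (j + 1)) ^ 2 * (a (x j.succ) - a (x j.castSucc)) ^ 2 ≤ θsq * 1 :=
            mul_le_mul h1 h2 (sq_nonneg _) hθ0
        _ = θsq := mul_one _
    calc ∑ j : Fin K, (Φ (x ∘ levelSwap j) - Φ x) ^ 2 ≤ ∑ _j : Fin K, θsq := sum_le_sum fun j _ => hj j
      _ = K * θsq := by rw [sum_const, card_univ, Fintype.card_fin, nsmul_eq_mul]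
  -- the redraw part
  have hrd : ∑ v, ν v * (Φ (update x 0 v) - Φ x) ^ 2 ≤ c 0 ^ 2 := by
    have hv : ∀ v, ν v * (Φ (update x 0 v) - Φ x) ^ 2 ≤ ν v * c 0 ^ 2 := by
      intro v
      rw [oneLevel_update_zero hΦ x v, add_sub_cancel_left, mul_pow]
      refine mul_le_mul_of_nonneg_left ?_ (hν v).le
      calc c 0 ^ 2 * (a v - a (x 0)) ^ 2 ≤ c 0 ^ 2 * 1 := mul_le_mul_of_nonneg_left (ha v (x 0)) (sq_nonneg _)
        _ = c 0 ^ 2 := mul_one _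
    calc ∑ v, ν v * (Φ (update x 0 v) - Φ x) ^ 2 ≤ ∑ v, ν v * c 0 ^ 2 := sum_le_sum fun v _ => hv v
      _ = c 0 ^ 2 := by rw [← sum_mul, hν1, one_mul]
  have e0 : ((0 : ℝ)) ^ 2 = 0 := by norm_num
  rw [e0, mul_zero, add_zero]
  have h1 : t / K * ∑ j : Fin K, (Φ (x ∘ levelSwap j) - Φ x) ^ 2 ≤ t * θsq := by
    calc t / K * ∑ j : Fin K, (Φ (x ∘ levelSwap j) - Φ x) ^ 2 ≤ t / K * (K * θsq) := mul_le_mul_of_nonneg_left hsw (by positivity)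
      _ = t * θsq := by field_simp
  have h2 : (1 - t) * (w 0 * ∑ v, ν v * (Φ (update x 0 v) - Φ x) ^ 2) ≤ (1 - t) * w 0 * c 0 ^ 2 := by
    rw [mul_assoc]
    exact mul_le_mul_of_nonneg_left (mul_le_mul_of_nonneg_left hrd hw0) (by linarith)
  linarith

end Ladder

end Summit.Ventures.LatticeQCDFlow.Scaling

end
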